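import Literature.Probability.Percolation.AdjProb
import Literature.Probability.Percolation.AdjOrder
import HarnessLib

/-!
# The covering lemma of the adjacent outer landing: from four routed exits to the slots

Topic `Literature/Probability/Percolation`; family `crit-perc` / near-critical percolation on `𝕋`.
A brick of the near-critical arm-separation theorem for four arms in the ADJACENT colour
arrangement (P. Nolin, EJP 13 (2008), Thm. 11, `j = 4`, `σ = BBWW` [arXiv 0711.4948: Thm. 10],
landing step, §4.4 p. 12); the adjacent twin of `exists_slot_of_mem` / `real_outMidTiny4_le_at`
(`ArmSeparationOutCoverFour.lean`). This file is the pure combinatorics of the cover: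

* `OutMidExits4 P` — **four exits with clean routes, middle tips and an order certificate**: for
  each of the exits `a` (`0, 1` open, `2, 3` closed) a side `i a < 6`, an exit `F a` over the side
  frame of the colour-read configuration, its clean route (`PathIn`, tight outside `Λ_{2M}`), its
  kind and its actual tip row `t a` (`F.z₁` is the nominal row); the two structures of one colour
  disjoint; middle tips; the row-gap clauses of `AdjTipData.Good` on a common side; and the tip
  keys `rotKey M (i a) (t a)` in the cyclic order `0, 1, 2, 3`;
* `exists_aslot_of_mem` — every such configuration lies in `armsE true ∩ armsE false` of a routed
  slot of `aslotFinset P` (the tip data, `exists_tgt`, `exists_route`, `routeOK_slotOf`, `slotOf`);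
* `real_outMidExits4_le_at` — **`P_p(OutMidExits4) · (c^(B+3))⁴ ≤ #slots · P_p(extFourAdjR n (4M))`**.

Everything here is proved; no named facts are introduced.

## References

* P. Nolin, Near-critical percolation in two dimensions, *Electron. J. Probab.* 13 (2008), §4.3
  Prop. 12 (i), Lemma 13, §4.4 (arXiv 0711.4948: Prop. 11, Lemma 12; proof of Thm. 10, p. 12) [Nolin2008].
-/

noncomputable section

open Set MeasureTheory

namespace Literature.Probability.Percolation

open LatticeModels Tube Lanes AdjTipData

/-! ### Transfer of cyclic comparisons along an order correspondence -/

/-- Cyclic comparisons only depend on the linear order of the points. [folklore] -/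
theorem cyc_lt_cyc_iff_of_order {N : ℤ} {a b c a' b' c' : ℤ}
    (_ha : 0 ≤ a ∧ a < N) (hb : 0 ≤ b ∧ b < N) (hc : 0 ≤ c ∧ c < N) (_ha' : 0 ≤ a' ∧ a' < N) (hb' : 0 ≤ b' ∧ b' < N) (hc' : 0 ≤ c' ∧ c' < N)
    (hab : a ≠ b) (hac : a ≠ c) (hbc : b ≠ c) (hab' : a' ≠ b') (hac' : a' ≠ c') (hbc' : b' ≠ c')
    (e1 : a < b ↔ a' < b') (e2 : a < c ↔ a' < c') (e3 : b < c ↔ b' < c') :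
    cyc N a b < cyc N a c ↔ cyc N a' b' < cyc N a' c' := by
  simp only [cyc_eq_ite]
  split_ifs <;> omega

/-- **Labels from the separation pattern**: four distinct points of the circle `ℤ/Nℤ`, two "open"
`o₁, o₂` and two "closed" `c₁, c₂`, with `{c₁, c₂}` NOT separating `{o₁, o₂}`; then, for one of the
two orders of the open points and one of the closed points, the four read anticlockwise
open, open, closed, closed. [cite: Nolin2008, §4.1 (arXiv 0711.4948, §4.1: σ up to cyclic permutation; BBWW)] -/
theorem exists_chain_of_not_hexSep {N : ℤ} {o₁ o₂ c₁ c₂ : ℤ}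
    (ho₁ : 0 ≤ o₁ ∧ o₁ < N) (ho₂ : 0 ≤ o₂ ∧ o₂ < N) (hc₁ : 0 ≤ c₁ ∧ c₁ < N) (hc₂ : 0 ≤ c₂ ∧ c₂ < N)
    (h12 : o₁ ≠ o₂) (h1c : o₁ ≠ c₁) (h1d : o₁ ≠ c₂) (h2c : o₂ ≠ c₁) (h2d : o₂ ≠ c₂) (hcd : c₁ ≠ c₂)
    (hsep : ¬ HexSep c₁ c₂ o₁ o₂) :
    ∃ o o' c c' : ℤ, ({o, o'} : Set ℤ) = {o₁, o₂} ∧ ({c, c'} : Set ℤ) = {c₁, c₂} ∧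
      cyc N o o' < cyc N o c ∧ cyc N o c < cyc N o c' := by
  unfold HexSep HexBtw at hsep
  simp only [cyc_eq_ite]
  -- the candidate labelings; pick by the linear order of the four points
  rcases lt_or_gt_of_ne h12 with a | a <;> rcases lt_or_gt_of_ne hcd with b | b <;>
    rcases lt_or_gt_of_ne h1c with e | e <;> rcases lt_or_gt_of_ne h2c with f | f <;>
    rcases lt_or_gt_of_ne h1d with g | g <;> rcases lt_or_gt_of_ne h2d with k | k <;>
    first
    | (refine ⟨o₁, o₂, c₁, c₂, rfl, rfl, ?_, ?_⟩ <;> (split_ifs <;> omega))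
    | (refine ⟨o₁, o₂, c₂, c₁, rfl, Set.pair_comm _ _, ?_, ?_⟩ <;> (split_ifs <;> omega))
    | (refine ⟨o₂, o₁, c₁, c₂, Set.pair_comm _ _, rfl, ?_, ?_⟩ <;> (split_ifs <;> omega))
    | (refine ⟨o₂, o₁, c₂, c₁, Set.pair_comm _ _, Set.pair_comm _ _, ?_, ?_⟩ <;> (split_ifs <;> omega))

/-! ### The event -/

/-- colour of the exit `a` as a Boolean configuration reading: open for `a = 0, 1` [folklore] -/
theorem col_eq (a : Fin 4) : col a = decide ((a : ℕ) < 2) := rfl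

/-- **Four exits with clean routes, middle tips and the order certificate** (the output of the
surgery on four adjacent arms; the input of the cover). [cite: Nolin2008, §4.2 Def. 6–8, §4.4 (arXiv 0711.4948: Def. 6–8; proof of Thm. 10, p. 12), σ = BBWW] -/
def OutMidExits4 (P : OParams) : Set (SiteConfig (Site 2)) :=
  {ω | ∃ (i : Fin 4 → ℕ) (up : Fin 4 → Bool) (t : Fin 4 → ℤ)
      (F : (a : Fin 4) → TrapExit P.M P.n P.k₀ P.K (rotConfig (i a) (colCfg (col a) ω))) (S : Fin 4 → Set (Site 2)),
    (∀ a, i a < 6) ∧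
    (∀ a, (F a).z 1 = (if up a then t a - 3 * ((F a).k : ℤ) else t a)) ∧
    (∀ a, -(2 * (P.M : ℤ)) + P.R₀ + 3 * (F a).k ≤ t a ∧ t a ≤ -(P.R₀ : ℤ)) ∧
    (∀ a, PathIn triGraph (S a) (F a).a (F a).m) ∧
    (∀ a, S a ⊆ (triAnnSet P.n (2 * P.M) ∪ trapExitZone P.M (F a).z (F a).k) ∩ rotConfig (i a) (colCfg (col a) ω)) ∧
    (∀ a, ∀ v ∈ S a, 2 * (P.M : ℤ) < triNorm v → ExitTight (F a).z (F a).k v) ∧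
    (∀ a b, a ≠ b → col a = col b →
      Disjoint (triRotIsoPow (i a) '' (S a ∪ triStrip ((F a).z 0 + (F a).k) ((F a).z 1 + (F a).k) (F a).k (F a).k))
        (triRotIsoPow (i b) '' (S b ∪ triStrip ((F b).z 0 + (F b).k) ((F b).z 1 + (F b).k) (F b).k (F b).k))) ∧
    (∀ a b, a ≠ b → i a = i b → t a ≠ t b) ∧
    (∀ a b, a ≠ b → col a = col b → i a = i b → up a = false ∧ (t a < t b → t a + 17 * (F a).k < t b)) ∧
    (∀ a b, col a ≠ col b → i a = i b → ((up a = false ∧ t a < t b) ∨ (up a = true ∧ t b < t a)) →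
      t a + 8 * (F a).k < t b ∨ t b + 8 * (F a).k < t a) ∧
    (cyc (12 * P.M) (rotKey P.M (i 0) (t 0)) (rotKey P.M (i 1) (t 1)) < cyc (12 * P.M) (rotKey P.M (i 0) (t 0)) (rotKey P.M (i 2) (t 2)) ∧
      cyc (12 * P.M) (rotKey P.M (i 0) (t 0)) (rotKey P.M (i 2) (t 2)) < cyc (12 * P.M) (rotKey P.M (i 0) (t 0)) (rotKey P.M (i 3) (t 3)))}

/-! ### The cover -/

/-- The window index of a nominal row: the window of the ring grid containing it. [folklore] -/
theorem window_of_row {P : OParams} (hV : P.ValidA) {ζ : ℤ} (h1 : -(P.rL 0 : ℤ) ≤ ζ) (h2 : ζ < 0) :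
    ∃ ν, ν < P.NwA ∧ P.TA ν ≤ ζ ∧ ζ < P.TA ν + P.w := by
  obtain ⟨-, hn1, -, hs1, hns⟩ := hV.ringA_facts (show 0 < 8 by norm_num)
  refine ⟨latIdx P.sA (P.rL 0) ζ, ?_, ?_, ?_⟩
  · have h := latIdx_lt (s := P.sA) (r := P.rL 0) (n := P.nA 0) hn1 (by exact_mod_cast hns) h2
    unfold OParams.NwA; omega
  · have := (latIdx_spec (s := P.sA) (r := P.rL 0) hs1 h1).1; unfold OParams.TA; linarith
  · have := (latIdx_spec (s := P.sA) (r := P.rL 0) hs1 h1).2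
    have hw : (P.w : ℤ) = P.sA := by norm_cast
    unfold OParams.TA; rw [hw]; linarith

/-- **The covering lemma**: a configuration of `OutMidExits4` lies in `armsE true ∩ armsE false` of
a routed slot. [cite: Nolin2008, §4.4 (arXiv 0711.4948: proof of Thm. 10, p. 12 — the sum over the finitely many landing data), σ = BBWW] -/
theorem exists_aslot_of_mem {P : OParams} (hV : P.ValidA) {ω : SiteConfig (Site 2)} (hω : ω ∈ OutMidExits4 P) :
    ∃ σ ∈ aslotFinset P, σ.RouteOK P ∧ ω ∈ σ.armsE P true ∩ σ.armsE P false := by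
  classical
  obtain ⟨i, up, t, F, S, hi, hz, hmid, hP, hS, ht, hdisj, htne, hsame, hdiff, hord⟩ := hω
  obtain ⟨hs, hk₀, hμ, hw1, hw2, -, -, -, -, -, -, -, -, -, -, hN, -, -, hn, hμM, hR₀, hR₀M, -⟩ := hV.toValid.ifacts
  obtain ⟨-, hn1, h2M, hs1, hns⟩ := hV.ringA_facts (show 0 < 8 by norm_num)
  -- scales
  have hk : ∀ a, (F a).k = trapScale P.k₀ (F a).j := fun a => rfl
  have hkb : ∀ a, (P.k₀ : ℤ) ≤ (F a).k ∧ 32 * ((F a).k : ℤ) ≤ P.μ := fun a =>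
    ⟨by exact_mod_cast le_trapScale P.k₀ (F a).j, by exact_mod_cast P.scale_le (F a).j_lt⟩
  -- the nominal rows and their windows
  have hζb : ∀ a, -(P.rL 0 : ℤ) ≤ (F a).z 1 ∧ (F a).z 1 < 0 := fun a => by
    obtain ⟨m1, m2⟩ := hmid a; obtain ⟨k1, k2⟩ := hkb a; have e := hz a
    have h2M' : (2 * P.M : ℤ) ≤ P.rL 0 := by exact_mod_cast h2M
    constructor <;> split_ifs at e <;> omega
  choose ν hν hν1 hν2 using fun a => window_of_row hV (hζb a).1 (hζb a).2
  -- the tip data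
  set D : AdjTipData := ⟨i, fun a => (F a).j, up, t, ν⟩ with hD
  have hDk : ∀ a, D.k P a = (F a).k := fun a => rfl
  have hDζ : ∀ a, D.ζ P a = (F a).z 1 := fun a => by
    show (if up a then t a - 3 * ((F a).k : ℤ) else t a) = _; rw [hz a]
  have hgood : D.Good P :=
    { hi := hi
      hj := fun a => (F a).j_lt
      hν := hν
      hζ := fun a => by rw [hDζ]; exact ⟨hν1 a, hν2 a⟩
      hmid := fun a => by obtain ⟨m1, m2⟩ := hmid a; obtain ⟨k1, -⟩ := hkb a; exact ⟨by show _ ≤ t a; omega, m2⟩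
      htne := htne
      hsame := fun a b hab hc hiab => hsame a b hab hc hiab
      hdiff := fun a b hc hiab h => hdiff a b hc hiab h }
  -- the order certificate for the spoke keys
  have hchain : cyc (12 * P.M) (D.κ P 0) (D.κ P 1) < cyc (12 * P.M) (D.κ P 0) (D.κ P 2) ∧
      cyc (12 * P.M) (D.κ P 0) (D.κ P 2) < cyc (12 * P.M) (D.κ P 0) (D.κ P 3) := by
    have hr := fun a => hgood.κ_range hV a
    have hrt : ∀ a, 0 ≤ D.κt P a ∧ D.κt P a < 12 * P.M := fun a => by
      obtain ⟨m1, m2⟩ := hmid a; obtain ⟨k1, -⟩ := hkb a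
      have hi6 : (i a : ℤ) ≤ 5 := by have := hi a; omega
      have hi0 : (0 : ℤ) ≤ i a := by positivity
      have hM : (0 : ℤ) ≤ P.M := by positivity
      show 0 ≤ rotKey P.M (i a) (t a) ∧ rotKey P.M (i a) (t a) < 12 * P.M
      unfold rotKey; constructor <;> nlinarith
    have hne : ∀ {a b : Fin 4}, a ≠ b → D.κ P a ≠ D.κ P b := fun {a b} hab e => by
      rcases lt_trichotomy (D.κt P a) (D.κt P b) with h | h | h
      · exact absurd ((hgood.κt_lt_iff hV hab).1 h) (by rw [e]; exact lt_irrefl _)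
      · -- equal tip keys: same side and same tip row
        have hia : D.i a = D.i b := by
          by_contra hne'
          obtain ⟨m1, m2⟩ := hmid a; obtain ⟨m1', m2'⟩ := hmid b; obtain ⟨k1, -⟩ := hkb a; obtain ⟨k1', -⟩ := hkb b
          have hM : (0 : ℤ) ≤ P.M := by positivity
          change rotKey P.M (i a) (t a) = rotKey P.M (i b) (t b) at h
          unfold rotKey at h
          rcases Nat.lt_or_gt_of_ne hne' with hl | hl
          · have : (i a : ℤ) + 1 ≤ i b := by exact_mod_cast hl
            nlinarith
          · have : (i b : ℤ) + 1 ≤ i a := by exact_mod_cast hl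
            nlinarith
        have htt : t a = t b := by
          change rotKey P.M (i a) (t a) = rotKey P.M (i b) (t b) at h; unfold rotKey at h
          change i a = i b at hia; rw [hia] at h; linarith
        exact absurd htt (htne a b hab hia)
      · exact absurd ((hgood.κt_lt_iff hV (Ne.symm hab)).1 h) (by rw [e]; exact lt_irrefl _)
    have hnet : ∀ {a b : Fin 4}, a ≠ b → D.κt P a ≠ D.κt P b := fun {a b} hab e => by
      have h1 := hgood.κt_lt_iff hV hab; have h2 := hgood.κt_lt_iff hV (Ne.symm hab)
      rw [e] at h1 h2
      rcases lt_trichotomy (D.κ P a) (D.κ P b) with h | h | h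
      · exact absurd (h1.2 h) (lt_irrefl _)
      · exact hne hab h
      · exact absurd (h2.2 h) (lt_irrefl _)
    have tr := fun (a b c : Fin 4) (hab : a ≠ b) (hac : a ≠ c) (hbc : b ≠ c) =>
      cyc_lt_cyc_iff_of_order (hrt a) (hrt b) (hrt c) (hr a) (hr b) (hr c) (hnet hab) (hnet hac) (hnet hbc) (hne hab) (hne hac) (hne hbc)
        (hgood.κt_lt_iff hV hab) (hgood.κt_lt_iff hV hac) (hgood.κt_lt_iff hV hbc)
    exact ⟨(tr 0 1 2 (by decide) (by decide) (by decide)).1 hord.1, (tr 0 2 3 (by decide) (by decide) (by decide)).1 hord.2⟩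
  -- targets, route, slot
  obtain ⟨tc, htc, htgt⟩ := exists_tgt (P := P) D
  obtain ⟨R, hR⟩ := exists_route hV hgood hchain
  have hOK := routeOK_slotOf hV hgood htc htgt hR
  refine ⟨AdjTipData.slotOf P D tc R, ?_, hOK, ?_, ?_⟩
  · -- in the finite set of slots
    rw [mem_aslotFinset]
    intro q e
    have h7 := fun a => hV.nA_le_nA_seven (hOK.hlv a)
    obtain ⟨hast, haln1, haln⟩ := hOK.harc e
    have hGE : (AdjTipData.slotOf P D tc R).GE P e ≤ P.GrA 7 := by
      show P.GrA ((AdjTipData.slotOf P D tc R).lv e) ≤ P.GrA 7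
      unfold OParams.GrA; have := h7 e; omega
    fin_cases q
    · exact hi e
    · exact (F e).j_lt
    · exact hν e
    · exact hOK.hlv e
    · show (AdjTipData.slotOf P D tc R).ast e < P.GrA 7 + 1; omega
    · show (AdjTipData.slotOf P D tc R).aln e < P.GrA 7 + 1; omega
    · show (![R.r, tc 4, tc 5, 0] : Fin 4 → ℕ) e < (if (e : ℕ) = 0 then 6 else 5)
      fin_cases e
      · exact hR.hr
      · exact htc 4
      · exact htc 5
      · show (0 : ℕ) < 5; norm_num
    · exact htc e
  · -- the open exits
    refine ⟨F 0, F 1, S 0, S 1, rfl, rfl, ⟨hν1 0, hν2 0⟩, ⟨hν1 1, hν2 1⟩, ?_, ?_, hP 0, hP 1,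
      hS 0, hS 1, ht 0, ht 1, hdisj 0 1 (by decide) rfl⟩
    · obtain ⟨m1, m2⟩ := hmid 0; obtain ⟨k1, -⟩ := hkb 0; have e := hz 0; constructor <;> split_ifs at e <;> omega
    · obtain ⟨m1, m2⟩ := hmid 1; obtain ⟨k1, -⟩ := hkb 1; have e := hz 1; constructor <;> split_ifs at e <;> omega
  · -- the closed exits
    refine ⟨F 2, F 3, S 2, S 3, rfl, rfl, ⟨hν1 2, hν2 2⟩, ⟨hν1 3, hν2 3⟩, ?_, ?_, hP 2, hP 3,
      hS 2, hS 3, ht 2, ht 3, hdisj 2 3 (by decide) rfl⟩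
    · obtain ⟨m1, m2⟩ := hmid 2; obtain ⟨k1, -⟩ := hkb 2; have e := hz 2; constructor <;> split_ifs at e <;> omega
    · obtain ⟨m1, m2⟩ := hmid 3; obtain ⟨k1, -⟩ := hkb 3; have e := hz 3; constructor <;> split_ifs at e <;> omega

/-! ### The probability bound -/

/-- The number of slots. [folklore] -/
theorem card_aslotFinset (P : OParams) : (aslotFinset P).card = ∏ q : Fin 8, ∏ e : Fin 4, aslotBound P q e := by
  unfold aslotFinset aslotDataFinset
  rw [Finset.card_map, Fintype.card_piFinset]
  refine Finset.prod_congr rfl fun q _ => ?_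
  rw [Fintype.card_piFinset]
  exact Finset.prod_congr rfl fun e _ => Finset.card_range _

/-- **The adjacent outer landing step at `p`**:
`P_p(OutMidExits4) · (c^(B+3))⁴ ≤ (∏ aslotBound) · P_p(extFourAdjR n (4M))`. [cite: Nolin2008, §4.3 Prop. 12, Lemma 13, §4.4 (arXiv 0711.4948: Prop. 11, Lemma 12; proof of Thm. 10, p. 12: constants C₁, C₂), σ = BBWW] -/
theorem real_outMidExits4_le_at {P : OParams} (hV : P.ValidA) (p : unitInterval) {c : ℝ} {ρ Ncap B : ℕ}
    (hrsw : ∀ q : unitInterval, (q = p ∨ q = unitInterval.symm p) →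
      ∀ n : ℕ, 1 ≤ ⌊(ρ : ℝ) * n⌋₊ → n ≤ Ncap → c ≤ triLRCrossingProb q ⌊(ρ : ℝ) * n⌋₊ n)
    (hρ : 64 ≤ ρ) (hc : 0 ≤ c) (hsp : P.LL 7 ≤ ρ * (2 * P.ε)) (hcap : P.N' / 16 ≤ Ncap) (hB : P.GrA 7 ≤ B) :
    (triSitePercolation p).real (OutMidExits4 P) * (c ^ (B + 3)) ^ 4 ≤
      ((∏ q : Fin 8, ∏ e : Fin 4, aslotBound P q e : ℕ) : ℝ) * (triSitePercolation p).real (extFourAdjR P.n (4 * P.M)) := by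
  classical
  set S := (aslotFinset P).filter (fun σ => σ.RouteOK P) with hS
  have hsub : OutMidExits4 P ⊆ ⋃ σ ∈ S, σ.armsE P true ∩ σ.armsE P false := fun ω hω => by
    obtain ⟨σ, hσ, hro, hmem⟩ := exists_aslot_of_mem hV hω
    exact Set.mem_iUnion₂.2 ⟨σ, Finset.mem_filter.2 ⟨hσ, hro⟩, hmem⟩
  have hS' : ∀ σ ∈ S, σ.RouteOK P := fun σ hσ => (Finset.mem_filter.1 hσ).2
  have h1 := real_biUnion_armsE_le hV p hrsw hρ hc hsp hcap hB S hS'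
  have hcard : (S.card : ℝ) ≤ ((∏ q : Fin 8, ∏ e : Fin 4, aslotBound P q e : ℕ) : ℝ) := by
    exact_mod_cast (Finset.card_filter_le _ _).trans (card_aslotFinset P).le
  have hq0 : 0 ≤ (c ^ (B + 3)) ^ 4 := by positivity
  calc (triSitePercolation p).real (OutMidExits4 P) * (c ^ (B + 3)) ^ 4
      ≤ (triSitePercolation p).real (⋃ σ ∈ S, σ.armsE P true ∩ σ.armsE P false) * (c ^ (B + 3)) ^ 4 :=
        mul_le_mul_of_nonneg_right (measureReal_mono hsub (measure_ne_top _ _)) hq0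
    _ ≤ S.card * (triSitePercolation p).real (extFourAdjR P.n (4 * P.M)) := h1
    _ ≤ ((∏ q : Fin 8, ∏ e : Fin 4, aslotBound P q e : ℕ) : ℝ) * (triSitePercolation p).real (extFourAdjR P.n (4 * P.M)) :=
        mul_le_mul_of_nonneg_right hcard measureReal_nonneg

end Literature.Probability.Percolation
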